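import Summits.BirchSwinnertonDyer.Rank1Residual.ManinAdditive.NeronConwayR
import HarnessLib

/-!
# THE χ₋₄-TWIST EXPONENT LAWS of the Conway lattices at `16 ∣ N` — E-imc-136 `TwistExponentLaw`, E-imc-137
# `TwistRamanujanCoincidence` (cell `bsd-f2-manin`; conjecture leaf typed by the typer g13 from planner imc g18's
# Sketch-imc-g18d 0ac7d9613ee05a47 VERBATIM, T-imc-21, with refuter REF1 §R74 (HOME/ref1/R74-ref1-imc-g18d.md 7118c5f3a803f50b;
# kernel block ref1-C81-imc-g18d-audit.lean 6a32f0bf0ab2087e) folded)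

TYPER FRAMING.  imc's sketch VERBATIM (defs `quarterTranslate` (`t_{j/4}`), `twistOperatorAtTwo` (`Tw = (t_{1/4} − t_{3/4})/(2i)`);
@[conjecture] E-imc-136 `TwistExponentLaw`, E-imc-137 `TwistRamanujanCoincidence`; PROVED `ramanujanFour_eq_quarterTranslate_add`).
REF1 §R74: «Tw/t_{j/4} normalisations sound (A81.1–A81.4: t_{1/4} = R₄/2 + i·Tw in kernel); E-136/137 LAWS, typed fine, BC7 CLEAN;
E-136 (ii) is implied by E-137 off defect levels (A81.5)».  REF1's kernel lemmas A81.1–A81.5 are landed below with attribution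
(`quarterTranslate_two_eq`, `twistOperatorAtTwo_two_eq`, `quarterTranslate_one_eq`, `quarterTranslate_three_eq`,
`two_smul_twistOperatorAtTwo`, `two_smul_twist_mem_of_noDefect`).  CAVEAT (imc, MEMO-imc §24 (24.16)(c)): these are STRUCTURE laws
of the Conway lattices, NOT Manin certificates (the Gaussian lattice does not bound the Néron lattice: `ℚ₂(i)/ℚ₂` is wildly ramified).
bears_on: stmt-BirchSwinnertonDyer-22967.  Nothing asserted beyond PROVED theorems.  BSD is not proved by this; Manin's conjecture
is not proved by this.

# Sketch-imc-g18d — the χ₋₄-TWIST EXPONENT LAWS (imc g18, ENGINE 6 v10–v12, kit j312968; nothing asserted)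

On `S₂(Γ₀(N))`, `16 ∣ N`, write `t_{1/4} = ε_ev + i·Tw` with `ε_ev = R₄/2` (`aₙ ↦ Re(iⁿ) aₙ`) and the **twist
component** `Tw = (t_{1/4} − t_{3/4})/(2i)` (`aₙ ↦ Im(iⁿ) aₙ = χ₋₄(n) aₙ`, i.e. `Tw f = f ⊗ χ₋₄` coefficientwise; it maps
`J₀(N)` to `J₀(N)^{χ₋₄} ≅ J₀(N)` and is defined over `ℚ(i)`, NOT over `ℚ`).  ENGINE 6 v12 (24 levels `16 ∣ N ≤ 400`) finds a
RIGID TRICHOTOMY of exponents (`e(A|L)` := least `e` with `2^e A L ⊆ L`):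
  `e(R₄|S^G) = 0, e(R₄/2|S^G) = e(Tw|S^G) = 1, e(Tw|S^{G,R}) = 1`   at the 13 levels with no `R₄`-defect,
  `e(R₄|S^G) = 1, e(R₄/2|S^G) = e(Tw|S^G) = 2, e(Tw|S^{G,R}) = 1`   at the 10 `R₄`-defect levels (176, 224, 240, 272, 304, 320, 336, 352, 368, 384),
  all exponents `0` at `N = 32` (`d = 1`, the CM form `32a` is `χ₋₄`-twist-stable).
LAWS (E-blind, decidable level by level): E-imc-136 `TwistExponentLaw` — `2·Tw` preserves the End-saturated Conway lattice and
`4·Tw` preserves the Conway lattice, for every `16 ∣ N`; E-imc-137 `TwistRamanujanCoincidence` — `2·Tw` preserves `S^G` iff `R₄`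
does (iff no `R₄`-defect).  Informal content: `S^{G,R} ⊗ ℤ[i]` is stable under BOTH `t_{1/4} + t_{3/4}` and `t_{1/4} − t_{3/4}`,
hence under `2 t_{1/4}`, though never under `t_{1/4}` itself (GAUSS column: the largest `t_{1/4}`-stable Gaussian sublattice has
index `2^{1…22}` in it).  CAVEAT recorded in MEMO-imc §24 (24.16): the Gaussian lattice is NOT a certified bound for the Néron
lattice (`ℚ₂(i)/ℚ₂` is wildly ramified; the Néron lattice can shrink under that base change), so these laws are STRUCTURE of the
Conway lattices, not new Manin certificates.  Sources: HOME/imc/kit-g18/g18-neronconway-DEG-EXP-GAUSS-v12.txt d8accf5042e4a137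
(EXP lines), engine neronconway12.gp.  [cite: AtkinLehner1970, §4 (shape only: `z ↦ z + j/4` normalises `Γ₀(N)` for `16 ∣ N`);
the laws are the cell's rows E-imc-136/137, NOT in print]
-/
open scoped MatrixGroups ModularForm
open CongruenceSubgroup Literature.NumberTheory.EllipticCurves.ModularForms
open Summit.BirchSwinnertonDyer.Rank1Residual.ManinAdditive
open Summit.BirchSwinnertonDyer.Rank1Residual.ManinAdditive.ConwayCut
open Summit.BirchSwinnertonDyer.Rank1Residual.ManinAdditive.NeronConway
open Summit.BirchSwinnertonDyer.Rank1Residual.ManinAdditive.NeronConwayR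

noncomputable section

namespace Summit.BirchSwinnertonDyer.Rank1Residual.ManinAdditive.NeronConwayTw

variable (N : ℕ) [NeZero N] (k : ℤ)

/-- The translation `t_{j/4} : f ↦ f(z + j/4)` on `S_k(Γ₀(N))`, `16 ∣ N`, normalised like `ramanujanFour`
(`16^{1−k/2}` times the double-coset operator of `quarterTranslateGL j`, a single coset when `16 ∣ N`); on `q`-expansions
`aₙ ↦ i^{jn} aₙ`.  Junk if `16 ∤ N`.  `ramanujanFour N k = quarterTranslate N k 1 + quarterTranslate N k 3`. [folklore] -/
def quarterTranslate (j : ℕ) : CuspForm (Gamma0 N) k →ₗ[ℂ] CuspForm (Gamma0 N) k :=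
  (((16 : ℝ) ^ (1 - (k : ℝ) / 2) : ℝ) : ℂ) • cuspHeckeOperatorₗ (Gamma0 N) k (quarterTranslateGL j)

/-- The **twist component at 2**, `Tw := (t_{1/4} − t_{3/4})/(2i)`: on `q`-expansions `aₙ ↦ χ₋₄(n) aₙ`
(`0, 1, 0, −1` for `n ≡ 0, 1, 2, 3 mod 4`), i.e. `Tw f = f ⊗ χ₋₄` coefficientwise (typed like
`ConwayNortonThree.twistOperatorAtThree`). [folklore] -/
def twistOperatorAtTwo : CuspForm (Gamma0 N) k →ₗ[ℂ] CuspForm (Gamma0 N) k :=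
  (2 * Complex.I)⁻¹ • (quarterTranslate N k 1 - quarterTranslate N k 3)

/-- **E-imc-136 `TwistExponentLaw`** (LAW, E-blind, decidable level by level; ENGINE 6 v12 24/24 levels `16 ∣ N ≤ 400`):
`2·Tw` preserves the End-saturated Conway lattice `S^{G,R}(N)` and `4·Tw` preserves the Conway lattice `S^G(N)`.
Why it might fail: a level `16 ∣ N > 400` (first untested: `416`, an `R₄`-defect level) with `e(Tw|S^{G,R}) = 2`; the `64 ∣ N`
levels carry the extra generator `R₈` whose interaction with `Tw` is tested at 5 levels only. -/
@[conjecture]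
def TwistExponentLaw : Prop :=
  ∀ (N : ℕ) [NeZero N], 16 ∣ N →
    (∀ x ∈ endSaturatedConwayLattice N, (2 : ℤ) • twistOperatorAtTwo N 2 x ∈ endSaturatedConwayLattice N) ∧
    (∀ x ∈ conwayStableLattice N, (4 : ℤ) • twistOperatorAtTwo N 2 x ∈ conwayStableLattice N)

/-- **E-imc-137 `TwistRamanujanCoincidence`** (LAW, E-blind; ENGINE 6 v12 24/24): `2·Tw` preserves the Conway lattice
`S^G(N)` iff `R₄` does — the twist defect and the Ramanujan defect of `S^G` switch on at exactly the same levels (and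
`e(R₄/2|S^G) = e(Tw|S^G)` throughout).  Why it might fail: the two defects have different fine structure already
(`ord₂ [S^G : S^G ∩ (2Tw)⁻¹ S^G] = 5…9` at defect levels versus `ord₂ R₄def = 1, 2`), so the coincidence of their SUPPORTS
may be an artefact of `N ≤ 400`. -/
@[conjecture]
def TwistRamanujanCoincidence : Prop :=
  ∀ (N : ℕ) [NeZero N], 16 ∣ N →
    ((∀ x ∈ conwayStableLattice N, (2 : ℤ) • twistOperatorAtTwo N 2 x ∈ conwayStableLattice N) ↔
     (∀ x ∈ conwayStableLattice N, ramanujanFour N 2 x ∈ conwayStableLattice N))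

/-- Definitional edge: `R₄ = t_{1/4} + t_{3/4}` in the normalisation above. -/
theorem ramanujanFour_eq_quarterTranslate_add :
    ramanujanFour N k = quarterTranslate N k 1 + quarterTranslate N k 3 := by
  simp only [ramanujanFour, quarterTranslate, smul_add]

/-! ### REF1 §R74 kernel lemmas A81.1–A81.5 (refuter-ref1, HOME/ref1/ref1-C81-imc-g18d-audit.lean; landed with attribution) -/

section RefAudit81

variable {N k}

/-- A81.1  `t_{j/4}` carries no scalar at weight 2 (`16^{1−2/2} = 1`): `quarterTranslate N 2 j` is the bare coset operator of
`(4 j; 0 4)`, `q`-action `aₙ ↦ i^{jn} aₙ`. -/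
theorem quarterTranslate_two_eq (N : ℕ) [NeZero N] (j : ℕ) :
    quarterTranslate N 2 j = cuspHeckeOperatorₗ (Gamma0 N) 2 (quarterTranslateGL j) := by
  rw [show quarterTranslate N 2 j = (((16 : ℝ) ^ (1 - ((2 : ℤ) : ℝ) / 2) : ℝ) : ℂ) •
      cuspHeckeOperatorₗ (Gamma0 N) 2 (quarterTranslateGL j) from rfl,
    show ((16 : ℝ) ^ (1 - ((2 : ℤ) : ℝ) / 2)) = 1 by norm_num]
  simp

/-- A81.2  Hence `Tw = (2i)⁻¹ (t_{1/4} − t_{3/4})` at weight 2 is `(2i)⁻¹ •` (difference of the two bare coset operators):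
`aₙ ↦ (iⁿ − (−i)ⁿ)/(2i) · aₙ = χ₋₄(n) aₙ` — the docstring's `q`-action is the right one for THIS normalisation. -/
theorem twistOperatorAtTwo_two_eq (N : ℕ) [NeZero N] :
    twistOperatorAtTwo N 2 = (2 * Complex.I)⁻¹ •
      (cuspHeckeOperatorₗ (Gamma0 N) 2 (quarterTranslateGL 1) - cuspHeckeOperatorₗ (Gamma0 N) 2 (quarterTranslateGL 3)) := by
  rw [twistOperatorAtTwo, quarterTranslate_two_eq, quarterTranslate_two_eq]

/-- A81.3  The decomposition `t_{1/4} = R₄/2 + i·Tw` claimed in the module docstring (`ε_ev = R₄/2`), at every weight. -/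
theorem quarterTranslate_one_eq (N : ℕ) [NeZero N] (k : ℤ) :
    quarterTranslate N k 1 = (2 : ℂ)⁻¹ • ramanujanFour N k + Complex.I • twistOperatorAtTwo N k := by
  have h : Complex.I * (2 * Complex.I)⁻¹ = (2 : ℂ)⁻¹ := by
    rw [mul_inv, mul_left_comm, mul_inv_cancel₀ Complex.I_ne_zero, mul_one]
  rw [ramanujanFour_eq_quarterTranslate_add, twistOperatorAtTwo, smul_smul, h]
  module

/-- A81.3b  … and `t_{3/4} = R₄/2 − i·Tw`. -/
theorem quarterTranslate_three_eq (N : ℕ) [NeZero N] (k : ℤ) :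
    quarterTranslate N k 3 = (2 : ℂ)⁻¹ • ramanujanFour N k - Complex.I • twistOperatorAtTwo N k := by
  have h : Complex.I * (2 * Complex.I)⁻¹ = (2 : ℂ)⁻¹ := by
    rw [mul_inv, mul_left_comm, mul_inv_cancel₀ Complex.I_ne_zero, mul_one]
  rw [ramanujanFour_eq_quarterTranslate_add, twistOperatorAtTwo, smul_smul, h]
  module

/-- A81.4  `2·Tw = −i (t_{1/4} − t_{3/4})`: the operator in E-imc-136/137 is `−i` times a difference of two coset operators
with `ℤ[i]`-integral `q`-action, so `2·Tw` has `q`-action `2χ₋₄(n) aₙ ∈ ℤ` — a genuine lattice statement. -/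
theorem two_smul_twistOperatorAtTwo (N : ℕ) [NeZero N] (k : ℤ) :
    (2 : ℂ) • twistOperatorAtTwo N k = -Complex.I • (quarterTranslate N k 1 - quarterTranslate N k 3) := by
  rw [twistOperatorAtTwo, smul_smul, mul_inv, ← mul_assoc, mul_inv_cancel₀ (two_ne_zero), one_mul, Complex.inv_I]

/-- A81.5  E-imc-136 ∧ E-imc-137 ⟹ at every `16 ∣ N` WITHOUT `R₄`-defect, `2·Tw` already preserves `S^G` (the two laws are
jointly consistent; the content of E-136 (ii) is only at the defect levels). -/
theorem two_smul_twist_mem_of_noDefect (h137 : TwistRamanujanCoincidence) (N : ℕ) [NeZero N] (h16 : 16 ∣ N)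
    (hR : ∀ x ∈ conwayStableLattice N, ramanujanFour N 2 x ∈ conwayStableLattice N)
    {x : CuspForm (Gamma0 N) 2} (hx : x ∈ conwayStableLattice N) :
    (2 : ℤ) • twistOperatorAtTwo N 2 x ∈ conwayStableLattice N :=
  ((h137 N h16).mpr hR) x hx

end RefAudit81

end Summit.BirchSwinnertonDyer.Rank1Residual.ManinAdditive.NeronConwayTw

end
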